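import Summits.Ventures.PercRepro.S1CoreCapThirtyTwo

/-!
# PercRepro — THE AVERAGING CHAIN FOR `s₄` BY NULLITY, UNCONDITIONAL: `32, 53, 79, 114, 159, 216, 288, 376, …`
at `ν = 5, 6, 7, 8, 9, 10, 11, 12, …` (p2, gen 20; SUBCLAIM-S1 §6.4)

p1's averaging recursion (S1CoreCapAvg: `s₄(ν) − ⌊4·s₄(ν)/m⌋ ≤ s₄(ν − 1)`, `m` the number of non-coloops) run from
the kernel table `s₄ ≤ capKer 4 = 18` at nullity `4` instead of from a computed instance. The count of non-coloops:
`m ≥ ν + 4` at `ν = 5, 6` (the non-coloop part has rank `≥ 4`: rank `≤ 3` gives `≤ 6` points; S1CoreCapThirtyTwo,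
`card_nonColoops_ge_ten` below) and `m ≥ ν + 5` at `ν ≥ 7` (rank `≥ 5`: rank `≤ 4` gives `≤ 10` points — p1's
`card_nonColoops_ge`). Each step is `s ≤ ⌊m·B/(m − 4)⌋` (p1's `le_mul_div_of_sub_div_le`):

    ν      4   5   6   7    8    9    10   11   12   13   14   15
    m      –   9  10  12   13   14   15   16   17   18   19   20
    s₄ ≤  18  32  53  79  114  159  216  288  376  483  611  763

against the previous unconditional table `33 / 57 / 85 / 122` (`ν = 5 … 8`, S1CoreCapUncond) and the computed
chain `29 / 49 / 73 / 105 / 147 / 200 / 266 / 347` (modulo `Q*(5) = 11`). What it buys on the S1 map: `(12, 5)`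
(S1CoreCapThirtyTwo) and `(10, 11)` (`s₄ ≤ 288` at nullity `11`; the cell needs `≤ 362`).

* `card_nonColoops_ge_ten`, `ncard_fourCircuits_le_fifty_three_uncond` — nullity `6`;
* `avgChain`, **`ncard_fourCircuits_le_avgChain`** — the table as a theorem at every nullity;
* `avgChain_values`, `ncard_fourCircuits_le_two_eighty_eight_uncond` (nullity `11`) and the named values.
Axioms: standard.
-/

open scoped Matroid

namespace PercRepro

namespace S1

open Set

open FourCap

variable {α : Type}

/-- **The non-coloops of a core of nullity `6` number at least `10`**: `|E'| = r(E') + 6`; `r(E') ≤ 3` would give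
`|E'| ≤ 6`, hence `r(E') = 0` and `|E'| + 1 ≤ 1` — against `|E'| ≥ 6`. -/
theorem card_nonColoops_ge_ten (M : Matroid α) [M.Finite]
    (hfree : ∀ e ∈ M.E, ∃ A ⊆ M.E \ {e}, e ∉ M.closure A ∧ e ∉ M.closure ((M.E \ {e}) \ A))
    (hd : M.E.encard = M.eRank + 6) :
    10 ≤ (M.E \ M.coloops).ncard := by
  have hK : M.coloops ⊆ M.E := M.coloops_subset_ground
  have hE' : M.E \ M.coloops ⊆ M.E := sdiff_subset
  have hunion : (M.E \ M.coloops) ∪ M.coloops = M.E := sdiff_union_of_subset hK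
  have hr := PercRepro.eRk_union_subset_coloops (M := M) hE' subset_rfl disjoint_sdiff_left
  rw [hunion, ← _root_.Matroid.eRank_def] at hr
  have hcard := ncard_sdiff_add_ncard_of_subset hK M.ground_finite
  have hKfin : M.coloops.Finite := M.ground_finite.subset hK
  have hrE' : M.eRk (M.E \ M.coloops) ≠ ⊤ :=
    ne_top_of_le_ne_top (M.ground_finite.subset hE').encard_lt_top.ne (M.eRk_le_encard _)
  obtain ⟨r', hr'⟩ := ENat.ne_top_iff_exists.1 hrE'
  obtain ⟨R, hR⟩ := ENat.ne_top_iff_exists.1 (PercRepro.Matroid.eRank_ne_top_of_finite M)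
  have hRk : R = r' + M.coloops.ncard := by
    have := hr
    rw [← hR, ← hr', ← Set.Finite.cast_ncard_eq hKfin] at this
    exact_mod_cast this
  have hEn : M.E.ncard = R + 6 := by
    have := hd
    rw [← hR, ← Set.Finite.cast_ncard_eq M.ground_finite] at this
    exact_mod_cast this
  have hE'n : (M.E \ M.coloops).ncard = r' + 6 := by omega
  by_contra hlt
  push Not at hlt
  have hr'3 : r' ≤ 3 := by omega
  have h6 := ThmN.ncard_le_six_of_eRk_le_three_of_free M hfree hE' (by rw [← hr']; exact_mod_cast hr'3)
  have hr'0 : r' ≤ 0 := by omega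
  have h1 := ThmN.ncard_add_one_le_two_pow_of_eRk_le M (ThmN.not_isLoop_of_free M hfree) hfree 0
    (M.E \ M.coloops) hE' (by rw [← hr']; exact_mod_cast hr'0)
  norm_num at h1
  omega

/-- **`s₄ ≤ 53` on every core of nullity `6`, unconditionally**: the averaging recursion with `m = 10` on
`s₄ ≤ 32` at nullity `5` — `s − ⌊4s/10⌋ ≤ 32 ⟹ s ≤ 53`. -/
theorem ncard_fourCircuits_le_fifty_three_uncond (M : Matroid α) [M.Finite]
    (hfree : ∀ e ∈ M.E, ∃ A ⊆ M.E \ {e}, e ∉ M.closure A ∧ e ∉ M.closure ((M.E \ {e}) \ A))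
    (hd : M.E.encard = M.eRank + 6) : {C : Set α | M.IsCircuit C ∧ C.ncard = 4}.ncard ≤ 53 := by
  have hd' : M.E.encard = M.eRank + ((5 : ℕ) + 1) := by rw [hd]; norm_num
  have h := ncard_fourCircuits_sub_div_le_of_nonColoops M hfree hd' (by norm_num)
    (card_nonColoops_ge_ten M hfree hd) (B := 32)
    (fun M' _ hfree' hd5 => ncard_fourCircuits_le_thirty_two_uncond M' hfree' (by exact_mod_cast hd5))
  omega

/-- The unconditional averaging chain: the kernel table `0, 1, 5, 10, 18` at `ν ≤ 4` (`capKer`), `32` and `53` at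
`ν = 5, 6` (with `m = 9, 10`), then `avgChain (n + 7) = ⌊(n + 12)·avgChain (n + 6)/(n + 8)⌋` (with `m = n + 12`
non-coloops at nullity `n + 7`): `79, 114, 159, 216, 288, 376, 483, 611, 763, …`. -/
def avgChain : ℕ → ℕ
  | 0 => 0
  | 1 => 1
  | 2 => 5
  | 3 => 10
  | 4 => 18
  | 5 => 32
  | 6 => 53
  | n + 7 => (n + 12) * avgChain (n + 6) / (n + 12 - 4)

/-- The values `avgChain 7 = 79`, `8 ↦ 114`, `9 ↦ 159`, `10 ↦ 216`, `11 ↦ 288`, `12 ↦ 376`. -/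
theorem avgChain_values : avgChain 7 = 79 ∧ avgChain 8 = 114 ∧ avgChain 9 = 159 ∧ avgChain 10 = 216 ∧
    avgChain 11 = 288 ∧ avgChain 12 = 376 := by decide

/-- The chain starts below the kernel table: `capKer j ≤ avgChain j` for `j ≤ 4` (equality). -/
theorem capKer_le_avgChain : capKer 0 ≤ avgChain 0 ∧ capKer 1 ≤ avgChain 1 ∧ capKer 2 ≤ avgChain 2 ∧
    capKer 3 ≤ avgChain 3 ∧ capKer 4 ≤ avgChain 4 := by decide

/-- **`s₄ ≤ avgChain ν` on every core of nullity `ν`, unconditionally.** -/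
theorem ncard_fourCircuits_le_avgChain : ∀ (j : ℕ) (M : Matroid α) [M.Finite],
    (∀ e ∈ M.E, ∃ A ⊆ M.E \ {e}, e ∉ M.closure A ∧ e ∉ M.closure ((M.E \ {e}) \ A)) →
    M.E.encard = M.eRank + j → {C : Set α | M.IsCircuit C ∧ C.ncard = 4}.ncard ≤ avgChain j
  | 0, M, _, hfree, hd => (ncard_fourCircuits_le_capKer M hfree hd).trans capKer_le_avgChain.1
  | 1, M, _, hfree, hd => (ncard_fourCircuits_le_capKer M hfree hd).trans capKer_le_avgChain.2.1
  | 2, M, _, hfree, hd => (ncard_fourCircuits_le_capKer M hfree hd).trans capKer_le_avgChain.2.2.1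
  | 3, M, _, hfree, hd => (ncard_fourCircuits_le_capKer M hfree hd).trans capKer_le_avgChain.2.2.2.1
  | 4, M, _, hfree, hd => (ncard_fourCircuits_le_capKer M hfree hd).trans capKer_le_avgChain.2.2.2.2
  | 5, M, _, hfree, hd => ncard_fourCircuits_le_thirty_two_uncond M hfree (by exact_mod_cast hd)
  | 6, M, _, hfree, hd => ncard_fourCircuits_le_fifty_three_uncond M hfree (by exact_mod_cast hd)
  | n + 7, M, _, hfree, hd => by
    have hd' : M.E.encard = M.eRank + ((n + 6 : ℕ) + 1) := by rw [hd]; push_cast; ring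
    have h := ncard_fourCircuits_sub_div_le M hfree (d := n + 6) hd' (by omega)
      (fun M' _ hfree' hd6 => ncard_fourCircuits_le_avgChain (n + 6) M' hfree' hd6)
    have h2 := le_mul_div_of_sub_div_le (m := n + 12) (by omega) h
    show _ ≤ (n + 12) * avgChain (n + 6) / (n + 12 - 4)
    exact h2

/-- **`s₄ ≤ 79` on every core of nullity `7`**, unconditionally. -/
theorem ncard_fourCircuits_le_seventy_nine_uncond (M : Matroid α) [M.Finite]
    (hfree : ∀ e ∈ M.E, ∃ A ⊆ M.E \ {e}, e ∉ M.closure A ∧ e ∉ M.closure ((M.E \ {e}) \ A))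
    (hd : M.E.encard = M.eRank + 7) : {C : Set α | M.IsCircuit C ∧ C.ncard = 4}.ncard ≤ 79 := by
  have h := ncard_fourCircuits_le_avgChain 7 M hfree (by exact_mod_cast hd)
  rwa [avgChain_values.1] at h

/-- **`s₄ ≤ 114` on every core of nullity `8`**, unconditionally. -/
theorem ncard_fourCircuits_le_one_fourteen_uncond (M : Matroid α) [M.Finite]
    (hfree : ∀ e ∈ M.E, ∃ A ⊆ M.E \ {e}, e ∉ M.closure A ∧ e ∉ M.closure ((M.E \ {e}) \ A))
    (hd : M.E.encard = M.eRank + 8) : {C : Set α | M.IsCircuit C ∧ C.ncard = 4}.ncard ≤ 114 := by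
  have h := ncard_fourCircuits_le_avgChain 8 M hfree (by exact_mod_cast hd)
  rwa [avgChain_values.2.1] at h

/-- **`s₄ ≤ 288` on every core of nullity `11`**, unconditionally (the cell `(10, 11)` needs `≤ 362`). -/
theorem ncard_fourCircuits_le_two_eighty_eight_uncond (M : Matroid α) [M.Finite]
    (hfree : ∀ e ∈ M.E, ∃ A ⊆ M.E \ {e}, e ∉ M.closure A ∧ e ∉ M.closure ((M.E \ {e}) \ A))
    (hd : M.E.encard = M.eRank + 11) : {C : Set α | M.IsCircuit C ∧ C.ncard = 4}.ncard ≤ 288 := by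
  have h := ncard_fourCircuits_le_avgChain 11 M hfree (by exact_mod_cast hd)
  rwa [avgChain_values.2.2.2.2.1] at h

end S1

end PercRepro
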